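import Summits.QuantumFields.YangMills.Theorems.BalabanUVNodesN15KingModelLandauFlux
import HarnessLib

/-!
# BalabanUVNodes ∕ N15 — THE KING-MODEL RUNG (PART Ϡ-i): THE LANDAU GAP SURVIVES EVERY POSITIVE BLOCK PENALTY — for ANY averaging matrix `Q` and `a ≥ 0`, King's ∕ Bałaban's FULL fine
# operator shape `−cΔ_U + m² + a·Q^*Q` inherits every form bound of `−cΔ_U + m²`; at the constant-flux field: `Re⟨v,(−cΔ_U+m²+aQ^*Q)v⟩ ≥ (m² + cΛ(p′))‖v‖²`, `‖(−cΔ_U+m²+aQ^*Q)⁻¹‖ ≤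
# (m² + cΛ(p′))⁻¹`, and the MASSLESS full operator is invertible at non-zero small flux whatever `Q` is
# (Track A, DAG node N15 = NE2; FAN-OUT v1.1 §N15 s3 «KING-MODEL RUNG … + what the curved case adds»; count-neutral)

HONEST FRAMING.  Count-neutral (cell `pub-ymgap`, seat `pub-ymgap-dag-n15-e` g47; `--supports stmt-QuantumFields-27247 --as helper` = K3ᴬ, KEY MAP v3).  The propagators of the programme are
inverses of `Δ(U) + aQ(U)^*Q(U)`-type operators ([Balaban1985BackgroundPropagators] (3.23)–(3.24) p.394: `Δ^η_U + a(L^jη)^{−2}Q_j(U)^*Q_j(U)`-shape; King's `A = 0` version [King1986] (3.9)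
p.656, (4.4)–(4.5) p.670).  This file does NOT type Bałaban's covariant block mean `Q(U)` (its contour transport is not in the rung); it proves what holds for EVERY matrix `Q` from the
blocks to the sites: the penalty `aQ^*Q` is positive semidefinite, so the Landau floor of PART Ϡ-c passes to the full operator shape.  Generic linear algebra + PART Ϡ-c by name.  NOT a
node discharge (N15 of record untouched); nothing continuum ∕ ℝ⁴ ∕ OS ∕ Clay.

THE RESULTS:
* §1 GENERIC (any Hermitian `A` on `ℓ²(T × n)`, any `Q : Matrix ι (T × n) 𝕜`, `a ≥ 0`): `re_star_dotProduct_conjTranspose_mul_mulVec` (`Re⟨v,Q^*Qv⟩ = ‖Qv‖² ≥ 0`), `isHermitian_add_penalty`,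
  ★★ **`coercive_add_penalty`** (a form bound `κ·Σ‖v_x‖² ≤ Re⟨v,Av⟩` passes to `A + a·Q^*Q`), ★ `eigenvalues_ge_of_coercive'`, ★ `posDef_of_coercive'`, ★ `l2_opNorm_inv_le_of_coercive'`
  (the `κ`-engines of PART Ϡ-c for an arbitrary Hermitian matrix).
* §2 AT THE CONSTANT-FLUX FIELD (`U = fluxLink p ν₁`, `p_{ν₁} = 0`, `ν₀ ≠ ν₁`, `c ≥ 0`): ★★★ **`re_quadForm_fullOp_fluxLink_ge_landau`** (`(m² + cΛ(p′_{ν₀}))·Σ‖v_x‖² ≤ Re⟨v,(−cΔ_U+m²+aQ^*Q)v⟩`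
  for EVERY `Q`, `a ≥ 0`), ★★ `eigenvalues_fullOp_fluxLink_ge_landau`, ★★ **`posDef_fullOp_fluxLink_massless`** (`c > 0`, `p_{ν₀} ≠ 0`, `|p′| ≤ 1`: the MASSLESS full operator `−cΔ_U + aQ^*Q` is
  positive definite at non-zero small flux FOR EVERY `Q` — at `U ≡ 1` this needs the block term (`a > 0`, `Q` of full block rank: King's Lemma 4.3 ∕ Ͷ), here curvature alone does it), ★★
  **`l2_opNorm_fullOp_fluxLink_inv_le_landau`** (`‖(−cΔ_U+m²+aQ^*Q)⁻¹‖ ≤ (m² + cΛ(p′))⁻¹`), ★ `l2_opNorm_fullOp_fluxLink_massless_inv_le` (`≤ 4∕(c|p′|)`).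
PRIOR TREE ART (by name): Ϡ-a (`landauGap`, `landauGap_ge_quarter`), Ϡ-c (`re_quadForm_covLapF_fluxLink_ge_landau`, `landauGap_sOf_pos`), Ͱ-a (`covLapF`, `isHermitian_covLapF`), Ͱ-b (`fib`), Ͱ-f
(`sum_norm_fib_sq`, `re_star_dotProduct_le_norm_mul_norm`), Ͻ-q (`fluxLink`), Mathlib (`Matrix.IsHermitian.eigenvalues_eq`, `PosDef.of_dotProduct_mulVec_pos`, `Matrix.cstar_norm_def`,
`Matrix.isHermitian_conjTranspose_mul_self`).  Dedup (rg at filing): basename 0 files; needles `coercive_add_penalty|fullOp_fluxLink|_of_coercive'|re_star_dotProduct_conjTranspose_mul_mulVec` 0 tree files.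
Locators: [Balaban1985BackgroundPropagators] (3.23)–(3.24) p.394, (3.39) p.397; [King1986] (3.9) p.656, (4.4)–(4.5) p.670, Lemma 4.3 p.672.  0 `sorry`, 0 `def`.
-/

noncomputable section
open scoped BigOperators ComplexConjugate ComplexOrder Matrix.Norms.L2Operator
open Finset Matrix WithLp

namespace Summit.QuantumFields.YangMills.BalabanUVNodes.N15KingModelRung.Landau

open Literature.MathematicalPhysics.QuantumFieldTheory.Balaban1983to89.B5Prop11Plancherel (Tor unitVec sOf)
open Summit.QuantumFields.YangMills.BalabanUVNodes.N15KingModelRung.Covariant (covLapF fib isHermitian_covLapF sum_norm_fib_sq re_star_dotProduct_le_norm_mul_norm)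
open Summit.QuantumFields.YangMills.BalabanUVNodes.N15KingModelRung.Cover (fluxLink)

variable {d : ℕ} (K : Fin (d + 1) → ℕ)

/-! ## §1 Generic: a positive penalty preserves coercivity -/

section Generic

variable {𝕜 : Type*} [RCLike 𝕜] {n : Type*} [Fintype n] [DecidableEq n] {ι : Type*} [Fintype ι]
variable [hK : ∀ μ, NeZero (K μ)]

omit [DecidableEq n] in
/-- `⟨v, Q^*Qv⟩ = ⟨Qv, Qv⟩`, whose real part is `Σ|(Qv)_i|² ≥ 0`. [folklore] -/
theorem re_star_dotProduct_conjTranspose_mul_mulVec (Q : Matrix ι (Tor K × n) 𝕜) (v : Tor K × n → 𝕜) :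
    0 ≤ RCLike.re (star v ⬝ᵥ ((Qᴴ * Q) *ᵥ v)) := by
  rw [← mulVec_mulVec, dotProduct_mulVec, ← star_mulVec]
  have h : star (Q *ᵥ v) ⬝ᵥ (Q *ᵥ v) = ∑ i, star ((Q *ᵥ v) i) * (Q *ᵥ v) i := rfl
  rw [h, map_sum]
  exact Finset.sum_nonneg fun i _ => by rw [RCLike.star_def, RCLike.conj_mul, ← RCLike.ofReal_pow, RCLike.ofReal_re]; positivity

omit [Fintype n] [DecidableEq n] hK in
/-- `A + a·Q^*Q` is Hermitian when `A` is (`a` real). [folklore] -/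
theorem isHermitian_add_penalty {A : Matrix (Tor K × n) (Tor K × n) 𝕜} (hA : A.IsHermitian) (a : ℝ) (Q : Matrix ι (Tor K × n) 𝕜) :
    (A + (a : 𝕜) • (Qᴴ * Q)).IsHermitian := by
  refine hA.add ?_
  have hQ : (Qᴴ * Q).IsHermitian := Matrix.isHermitian_conjTranspose_mul_self Q
  unfold Matrix.IsHermitian at hQ ⊢
  rw [conjTranspose_smul, hQ, RCLike.star_def, RCLike.conj_ofReal]

omit [DecidableEq n] in
/-- ★★ **A POSITIVE PENALTY PRESERVES COERCIVITY**: `κ·Σ‖v_x‖² ≤ Re⟨v,Av⟩` for all `v` and `a ≥ 0` ⟹ `κ·Σ‖v_x‖² ≤ Re⟨v,(A + a·Q^*Q)v⟩` for all `v`.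
[cite: Balaban1985BackgroundPropagators, (3.23)–(3.24) p.394; King1986, (4.5) p.670] -/
theorem coercive_add_penalty {A : Matrix (Tor K × n) (Tor K × n) 𝕜} {κ : ℝ} (hcoer : ∀ v : Tor K × n → 𝕜, κ * ∑ x, ‖fib K v x‖ ^ 2 ≤ RCLike.re (star v ⬝ᵥ (A *ᵥ v)))
    {a : ℝ} (ha : 0 ≤ a) (Q : Matrix ι (Tor K × n) 𝕜) (v : Tor K × n → 𝕜) :
    κ * ∑ x, ‖fib K v x‖ ^ 2 ≤ RCLike.re (star v ⬝ᵥ ((A + (a : 𝕜) • (Qᴴ * Q)) *ᵥ v)) := by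
  rw [add_mulVec, dotProduct_add, map_add, Matrix.smul_mulVec, dotProduct_smul, smul_eq_mul, RCLike.re_ofReal_mul]
  have h := re_star_dotProduct_conjTranspose_mul_mulVec K Q v
  nlinarith [hcoer v, mul_nonneg ha h]

/-- ★ Coercivity ⟹ every eigenvalue `≥ κ` (any Hermitian `A`). [folklore] -/
theorem eigenvalues_ge_of_coercive' {A : Matrix (Tor K × n) (Tor K × n) 𝕜} (hA : A.IsHermitian) {κ : ℝ}
    (hcoer : ∀ v : Tor K × n → 𝕜, κ * ∑ x, ‖fib K v x‖ ^ 2 ≤ RCLike.re (star v ⬝ᵥ (A *ᵥ v))) (i : Tor K × n) : κ ≤ hA.eigenvalues i := by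
  rw [hA.eigenvalues_eq i]
  have h := hcoer (⇑(hA.eigenvectorBasis i))
  have hnorm : ‖(toLp 2 (⇑(hA.eigenvectorBasis i)) : EuclideanSpace 𝕜 (Tor K × n))‖ = 1 := hA.eigenvectorBasis.orthonormal.1 i
  rw [sum_norm_fib_sq, hnorm, one_pow, mul_one] at h
  exact h

omit [DecidableEq n] in
/-- ★ Coercivity with `κ > 0` ⟹ positive definite (any Hermitian `A`). [folklore] -/
theorem posDef_of_coercive' {A : Matrix (Tor K × n) (Tor K × n) 𝕜} (hA : A.IsHermitian) {κ : ℝ} (hκ : 0 < κ)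
    (hcoer : ∀ v : Tor K × n → 𝕜, κ * ∑ x, ‖fib K v x‖ ^ 2 ≤ RCLike.re (star v ⬝ᵥ (A *ᵥ v))) : A.PosDef := by
  refine PosDef.of_dotProduct_mulVec_pos hA fun v hv => ?_
  have h := hcoer v
  rw [sum_norm_fib_sq] at h
  have hvn : 0 < ‖(toLp 2 v : EuclideanSpace 𝕜 (Tor K × n))‖ ^ 2 := by
    have : (toLp 2 v : EuclideanSpace 𝕜 (Tor K × n)) ≠ 0 := fun h0 => hv (by simpa using congrArg ofLp h0)
    positivity
  exact RCLike.pos_iff.mpr ⟨lt_of_lt_of_le (mul_pos hκ hvn) h, hA.im_star_dotProduct_mulVec_self v⟩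

/-- ★ Coercivity with `κ > 0` ⟹ `‖A⁻¹‖_{ℓ²→ℓ²} ≤ κ⁻¹` (any Hermitian `A`). [cite: Balaban1985BackgroundPropagators, (3.39) p.397] -/
theorem l2_opNorm_inv_le_of_coercive' {A : Matrix (Tor K × n) (Tor K × n) 𝕜} (hA : A.IsHermitian) {κ : ℝ} (hκ : 0 < κ)
    (hcoer : ∀ v : Tor K × n → 𝕜, κ * ∑ x, ‖fib K v x‖ ^ 2 ≤ RCLike.re (star v ⬝ᵥ (A *ᵥ v))) : ‖A⁻¹‖ ≤ κ⁻¹ := by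
  have hdet : IsUnit A.det := (Matrix.isUnit_iff_isUnit_det _).mp (posDef_of_coercive' K hA hκ hcoer).isUnit
  rw [Matrix.cstar_norm_def]
  refine ContinuousLinearMap.opNorm_le_bound _ (inv_nonneg.2 hκ.le) fun w' => ?_
  have hw' : w' = toLp 2 (ofLp w') := rfl
  rw [hw', Matrix.toEuclideanCLM_toLp]
  set w := ofLp w'
  set v := A⁻¹ *ᵥ w with hv
  have hMv : A *ᵥ v = w := by rw [hv, mulVec_mulVec, Matrix.mul_nonsing_inv _ hdet, one_mulVec]
  have h1 := hcoer v
  rw [sum_norm_fib_sq, hMv] at h1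
  have h2 := re_star_dotProduct_le_norm_mul_norm K v w
  set α := ‖(toLp 2 v : EuclideanSpace 𝕜 (Tor K × n))‖ with hα
  set β := ‖(toLp 2 w : EuclideanSpace 𝕜 (Tor K × n))‖ with hβ
  have hα0 : 0 ≤ α := norm_nonneg _
  have hβ0 : 0 ≤ β := norm_nonneg _
  rw [le_inv_mul_iff₀ hκ]
  by_cases hz : α = 0
  · rw [hz, mul_zero]; exact hβ0
  · have hαpos : 0 < α := lt_of_le_of_ne hα0 (Ne.symm hz)
    nlinarith [h1, h2]

end Generic

/-! ## §2 The full operator shape at the constant-flux field -/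

section Flux

variable [hK : ∀ μ, NeZero (K μ)] {c : ℝ} {ι : Type*} [Fintype ι]

/-- ★★★ **THE LANDAU GAP OF THE FULL FINE OPERATOR SHAPE**: at `U = fluxLink p ν₁` (`p_{ν₁} = 0`, `ν₀ ≠ ν₁`, `c ≥ 0`), for EVERY averaging matrix `Q` and `a ≥ 0`:
`(m² + cΛ(p′_{ν₀}))·Σ‖v_x‖² ≤ Re⟨v,(−cΔ_U + m² + a·Q^*Q)v⟩`. [cite: Balaban1985BackgroundPropagators, (3.23)–(3.24) p.394; King1986, (4.4)–(4.5) p.670] -/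
theorem re_quadForm_fullOp_fluxLink_ge_landau (hc : 0 ≤ c) (m2 : ℝ) {p : Tor K} {ν₀ ν₁ : Fin (d + 1)} (hν : ν₀ ≠ ν₁) (hp : p ν₁ = 0) {a : ℝ} (ha : 0 ≤ a)
    (Q : Matrix ι (Tor K × Unit) ℂ) (v : Tor K × Unit → ℂ) :
    (m2 + c * landauGap (sOf K p ν₀)) * ∑ x, ‖fib K v x‖ ^ 2 ≤ RCLike.re (star v ⬝ᵥ ((covLapF K c m2 (fluxLink K p ν₁) + (a : ℂ) • (Qᴴ * Q)) *ᵥ v)) :=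
  coercive_add_penalty K (fun w => re_quadForm_covLapF_fluxLink_ge_landau K hc m2 hν hp w) ha Q v

/-- ★★ Every eigenvalue of the full operator shape is `≥ m² + cΛ(p′_{ν₀})`. [cite: King1986, (4.5) p.670] -/
theorem eigenvalues_fullOp_fluxLink_ge_landau (hc : 0 ≤ c) (m2 : ℝ) {p : Tor K} {ν₀ ν₁ : Fin (d + 1)} (hν : ν₀ ≠ ν₁) (hp : p ν₁ = 0) {a : ℝ} (ha : 0 ≤ a)
    (Q : Matrix ι (Tor K × Unit) ℂ) (i : Tor K × Unit) :
    m2 + c * landauGap (sOf K p ν₀) ≤ (isHermitian_add_penalty K (isHermitian_covLapF K c m2 (fluxLink K p ν₁)) a Q).eigenvalues i :=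
  eigenvalues_ge_of_coercive' K _ (fun v => re_quadForm_fullOp_fluxLink_ge_landau K hc m2 hν hp ha Q v) i

/-- ★★ **THE MASSLESS FULL OPERATOR `−cΔ_U + aQ^*Q` IS POSITIVE DEFINITE AT NON-ZERO SMALL FLUX, FOR EVERY `Q` AND `a ≥ 0`** (`c > 0`, `p_{ν₀} ≠ 0`, `|p′_{ν₀}| ≤ 1`) — at `U ≡ 1` this
requires the block penalty itself (`a > 0`, King's Lemma 4.3 ∕ PART Ͷ); at constant curvature the flux alone suffices. [cite: King1986, Lemma 4.3 p.672, (4.5) p.670; Balaban1985BackgroundPropagators, (3.24) p.394] -/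
theorem posDef_fullOp_fluxLink_massless (hc : 0 < c) {p : Tor K} {ν₀ ν₁ : Fin (d + 1)} (hν : ν₀ ≠ ν₁) (hp : p ν₁ = 0) (hp0 : p ν₀ ≠ 0) (hsmall : |sOf K p ν₀| ≤ 1)
    {a : ℝ} (ha : 0 ≤ a) (Q : Matrix ι (Tor K × Unit) ℂ) : (covLapF K c 0 (fluxLink K p ν₁) + (a : ℂ) • (Qᴴ * Q)).PosDef :=
  posDef_of_coercive' K (isHermitian_add_penalty K (isHermitian_covLapF K c 0 (fluxLink K p ν₁)) a Q)
    (by rw [zero_add]; exact mul_pos hc (landauGap_sOf_pos K hp0 hsmall)) fun v => re_quadForm_fullOp_fluxLink_ge_landau K hc.le 0 hν hp ha Q v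

/-- ★★ **`‖(−cΔ_U + m² + aQ^*Q)⁻¹‖ ≤ (m² + cΛ(p′_{ν₀}))⁻¹`** for every `Q`, `a ≥ 0`, whenever the right side is positive — the full fine propagator shape inherits the Landau bound, uniformly
in the volume and in the averaging matrix. [cite: Balaban1985BackgroundPropagators, (3.39) p.397, (3.24) p.394; King1986, (4.5) p.670] -/
theorem l2_opNorm_fullOp_fluxLink_inv_le_landau (hc : 0 ≤ c) {m2 : ℝ} {p : Tor K} {ν₀ ν₁ : Fin (d + 1)} (hν : ν₀ ≠ ν₁) (hp : p ν₁ = 0) {a : ℝ} (ha : 0 ≤ a)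
    (Q : Matrix ι (Tor K × Unit) ℂ) (hpos : 0 < m2 + c * landauGap (sOf K p ν₀)) :
    ‖(covLapF K c m2 (fluxLink K p ν₁) + (a : ℂ) • (Qᴴ * Q))⁻¹‖ ≤ (m2 + c * landauGap (sOf K p ν₀))⁻¹ :=
  l2_opNorm_inv_le_of_coercive' K (isHermitian_add_penalty K (isHermitian_covLapF K c m2 (fluxLink K p ν₁)) a Q) hpos
    fun v => re_quadForm_fullOp_fluxLink_ge_landau K hc m2 hν hp ha Q v

/-- ★ The massless full propagator shape at small non-zero flux: `‖(−cΔ_U + aQ^*Q)⁻¹‖ ≤ 4∕(c|p′_{ν₀}|)` for every `Q`, `a ≥ 0` (`c > 0`, `0 < |p′| ≤ 1`).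
[cite: Balaban1985BackgroundPropagators, (3.39) p.397; King1986, (4.5) p.670] -/
theorem l2_opNorm_fullOp_fluxLink_massless_inv_le (hc : 0 < c) {p : Tor K} {ν₀ ν₁ : Fin (d + 1)} (hν : ν₀ ≠ ν₁) (hp : p ν₁ = 0) (hp0 : p ν₀ ≠ 0) (hsmall : |sOf K p ν₀| ≤ 1)
    {a : ℝ} (ha : 0 ≤ a) (Q : Matrix ι (Tor K × Unit) ℂ) :
    ‖(covLapF K c 0 (fluxLink K p ν₁) + (a : ℂ) • (Qᴴ * Q))⁻¹‖ ≤ 4 / (c * |sOf K p ν₀|) := by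
  have habs : 0 < |sOf K p ν₀| := abs_pos.mpr (by
    have h := landauGap_sOf_pos K hp0 hsmall
    intro h0; rw [h0, landauGap_zero] at h; exact lt_irrefl _ h)
  have hq : 0 < c * (|sOf K p ν₀| / 4) := by positivity
  have hκ : c * (|sOf K p ν₀| / 4) ≤ c * landauGap (sOf K p ν₀) := mul_le_mul_of_nonneg_left (landauGap_ge_quarter hsmall) hc.le
  have h := l2_opNorm_inv_le_of_coercive' K (isHermitian_add_penalty K (isHermitian_covLapF K c 0 (fluxLink K p ν₁)) a Q) hq
    (fun v => le_trans (by rw [zero_add]; exact mul_le_mul_of_nonneg_right hκ (Finset.sum_nonneg fun x _ => sq_nonneg _))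
      (re_quadForm_fullOp_fluxLink_ge_landau K hc.le 0 hν hp ha Q v))
  refine h.trans (le_of_eq ?_)
  rw [inv_eq_one_div, div_eq_div_iff (ne_of_gt hq) (mul_pos hc habs).ne']
  ring

end Flux

end Summit.QuantumFields.YangMills.BalabanUVNodes.N15KingModelRung.Landau

end
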